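/-
Copyright (c) 2026 the pub-hodgecm-mathlib formalisation cell (harness21).  Prover seat hodgecm-mathlib-K2Liu-p06 (g3): Track B «K2-LIT»,
hLiu418 = stmt-HodgeConjecture-24832; LEAD F0P6-plan (g12) 07:40:43Z «GO (Φ7-1)» item (i); 2026-09-04.
-/
import Summits.HodgeConjecture.HodgeConjecture.Theorems.K2LiuSiegelEisensteinCoeffOrbitCriterion   -- ★ survivor criterion (`S^{p'}` corner form)
import HarnessLib

/-!
# Crux `HLiu418`, ROAD Φ, organ Φ7-1 (i): A RANK-ONE INDEX HAS A CORNER-SUPPORTED CONJUGATE — for `S = u ⊗ w` `T_L`-skew and `w_k ≠ 0` there is a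
# rational Levi element `p'` with `S^{p'}_𝔸` supported at the single corner `(k,k)`, so the middle orbit `O(w_{χ_k} p')` is a candidate survivor

Cell `hodgecm-mathlib`, crux item hLiu418 = `stmt-HodgeConjecture-24832`, route `HCCMUnconditional`; squad K2 ∕ K2Liu, LEAD F0P6-plan (g12), dealer K2E5-plan (g6),
prover K2Liu-p06 (g3).  THEOREMS ONLY; lane `--supports stmt-HodgeConjecture-24832 --as helper` (count-neutral).

THE ALGEBRA (general `n`, any field-valued pattern index `k`).  Let `S = vecMulVec u w` (`S_{ij} = u_i w_j`) be `T_L`-skew (`T S + S^* T = 0`) with `w_k ≠ 0`.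
The Levi matrix `A₀ := 1.updateRow k w` (rows `e_j`, `j ≠ k`, and row `k` equal to `w`) is invertible (`det A₀ = w_k`, `det_updateRow_one`), has
`w ᵥ* A₀⁻¹ = e_k` (`vecMul_updateRow_one_inv`) and `A₀^* e_k = c ∘ w`; skewness forces `T u ∥ c ∘ w` (`mulVec_eq_smul_of_skew`), so the Levi co-block
`D₀ = T⁻¹ (A₀⁻¹)^* T` sends `u` to a multiple of `e_k` (`leviD_mulVec_eq_smul_single`).  Hence **`conj_index_eq_corner`**: `D₀ S A₀⁻¹ = μ · E_{kk}` is
supported on the corner of the singleton pattern `χ_k`.  Transported to `H(𝔸)` by ★ `exists_rat_siegel_frame₁₁` ∕ ★ `exists_rat_levi_blocks`: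
**`exists_corner_supported_levi`** — a rational `p' ∈ P_Δ(L⁺)` with `deltaBlock p' = A₀ ⊗ 1` and `S^{p'}_𝔸 = E_k S^{p'}_𝔸 E_k` in the currency of ★
`K2LiuSiegelEisensteinCoeffOrbitCriterion` (so, by its sharp criterion, the orbit of `[w_{χ_k} p']` carries no killing datum).  For `n = 2` every
`T_L`-skew `S ≠ 0` with `det S = 0` is such a `u ⊗ w` (sequel).  [KudlaRallis1994, §2], [Shimura1997, §18.3], [MoeglinWaldspurger1995, II.1.7].

HONEST LABEL.  Count-neutral helper; `HC_CM` is proved only modulo the 7 printed citations (2 remaining named inputs: hLiu418 = `stmt-HodgeConjecture-24832`,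
h413 = `stmt-HodgeConjecture-24833`) until rung 0 closes.
-/

set_option autoImplicit false
set_option linter.dupNamespace false -- the mandated namespace repeats `HodgeConjecture.HodgeConjecture`

noncomputable section

open scoped Matrix
open NumberField IsDedekindDomain
open Literature.NumberTheory.Automorphic Literature.NumberTheory.Automorphic.UnitaryGroup Literature.NumberTheory.GaloisRepresentations
open Literature.NumberTheory.GelbartRogawski1991 Literature.NumberTheory.GelbartRogawski1991.GRConstruction
open Literature.NumberTheory.K2Lit.SiegelDoubled
open UnitaryDualPair

namespace Summit.HodgeConjecture.HodgeConjecture.Cruxes.HLiu418.K2LiuSiegelEisensteinCoeffRankOneCorner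

open K2LiuSiegelUnipotentFourierDefs K2LiuSiegelDoubledRationalPoints K2LiuSiegelDoubledRationalFrames K2LiuSiegelLeviConjUnipDeltaChar
  K2LiuSiegelDoubledLeviMatrix

/-! ## §1 Linear algebra of the Levi matrix `A₀ = 1.updateRow k w` -/

section LinearAlgebra

variable {K : Type*} [Field K] {ι : Type*} [Fintype ι] [DecidableEq ι]

/-- `det (1.updateRow k w) = w_k`. [folklore] -/
theorem det_updateRow_one (k : ι) (w : ι → K) : ((1 : Matrix ι ι K).updateRow k w).det = w k := by
  have hw : w = ∑ i, w i • (1 : Matrix ι ι K) i :=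
    (pi_eq_sum_univ w).trans (Finset.sum_congr rfl fun i _ => rfl)
  conv_lhs => rw [hw]
  rw [Matrix.det_updateRow_sum, Matrix.det_one, smul_eq_mul, mul_one]

/-- row `k` of `1.updateRow k w` is `w`: `e_k ᵥ* A₀ = w`. [folklore] -/
theorem single_vecMul_updateRow_one (k : ι) (w : ι → K) :
    Pi.single k 1 ᵥ* (1 : Matrix ι ι K).updateRow k w = w := by
  rw [Matrix.single_one_vecMul]
  exact Matrix.updateRow_self

/-- `w ᵥ* A₀⁻¹ = e_k` for `A₀ = 1.updateRow k w`, `w_k ≠ 0`. [folklore] -/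
theorem vecMul_updateRow_one_inv {k : ι} {w : ι → K} (hk : w k ≠ 0) :
    w ᵥ* ((1 : Matrix ι ι K).updateRow k w)⁻¹ = Pi.single k 1 := by
  have hdet : IsUnit ((1 : Matrix ι ι K).updateRow k w).det := by rw [det_updateRow_one]; exact isUnit_iff_ne_zero.2 hk
  calc w ᵥ* ((1 : Matrix ι ι K).updateRow k w)⁻¹
      = (Pi.single k 1 ᵥ* (1 : Matrix ι ι K).updateRow k w) ᵥ* ((1 : Matrix ι ι K).updateRow k w)⁻¹ := by rw [single_vecMul_updateRow_one]
    _ = Pi.single k 1 := by rw [Matrix.vecMul_vecMul, Matrix.mul_nonsing_inv _ hdet, Matrix.vecMul_one]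

/-- `A₀^* e_k = c ∘ w` (`A^* = ᵗ(c A)`) for `A₀ = 1.updateRow k w`. [folklore] -/
theorem conjTranspose_updateRow_one_mulVec_single (c : K →+* K) (k : ι) (w : ι → K) :
    ((((1 : Matrix ι ι K).updateRow k w).map c)ᵀ) *ᵥ Pi.single k 1 = fun i => c (w i) := by
  rw [Matrix.mulVec_single_one]
  ext i
  simp [Matrix.col, Matrix.updateRow_self]

omit [DecidableEq ι] in
/-- **skewness aligns the two factors of a rank-one skew matrix**: if `S = u ⊗ w` is `T`-skew (`T S + S^* T = 0`) and `w_k ≠ 0` then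
`T u = λ · (c ∘ w)` with `λ = −((c∘u) ᵥ* T)_k ∕ w_k`. [folklore] -/
theorem mulVec_eq_smul_of_skew (c : K →+* K) {T S : Matrix ι ι K} {u w : ι → K} (hS1 : S = Matrix.vecMulVec u w)
    (hS : T * S + (S.map c)ᵀ * T = 0) {k : ι} (hk : w k ≠ 0) :
    T *ᵥ u = (-(((fun i => c (u i)) ᵥ* T) k / w k)) • fun i => c (w i) := by
  have hmap : S.map c = Matrix.vecMulVec (fun i => c (u i)) (fun j => c (w j)) := by
    rw [hS1]; ext i j; simp [Matrix.vecMulVec_apply]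
  rw [hmap, Matrix.transpose_vecMulVec, hS1, Matrix.mul_vecMulVec, Matrix.vecMulVec_mul] at hS
  ext i
  have h := congrFun (congrFun hS i) k
  simp only [Matrix.add_apply, Matrix.vecMulVec_apply, Matrix.zero_apply] at h
  -- `h : (T u)_i * w_k + c(w_i) * ((c∘u) ᵥ* T)_k = 0`
  rw [Pi.smul_apply, smul_eq_mul]
  field_simp
  linear_combination h

/-- **the Levi co-block straightens `u`**: for `A₀ = 1.updateRow k w` and `D₀ = T⁻¹ (A₀⁻¹)^* T` (the co-block of the Levi element of `A₀`, ★ `levi_rel`),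
`D₀ u = (λ ∕ t_k) · e_k` whenever `T u = λ · A₀^* e_k` and `T = diag(t)` is invertible. [folklore] -/
theorem leviD_mulVec_eq_smul_single (c : K →+* K) {t : ι → K} (ht : ∀ i, t i ≠ 0) {k : ι} {w u : ι → K} (hk : w k ≠ 0) {lam : K}
    (hu : Matrix.diagonal t *ᵥ u = lam • fun i => c (w i)) :
    ((Matrix.diagonal t)⁻¹ * ((((1 : Matrix ι ι K).updateRow k w)⁻¹).map c)ᵀ * Matrix.diagonal t) *ᵥ u = (lam * (t k)⁻¹) • Pi.single k 1 := by
  have hdet : IsUnit ((1 : Matrix ι ι K).updateRow k w).det := by rw [det_updateRow_one]; exact isUnit_iff_ne_zero.2 hk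
  -- `(A₀⁻¹)^* A₀^* = 1`
  have hinv : ((((1 : Matrix ι ι K).updateRow k w)⁻¹).map c)ᵀ * ((((1 : Matrix ι ι K).updateRow k w)).map c)ᵀ = 1 := by
    rw [← Matrix.transpose_mul, ← Matrix.map_mul, Matrix.mul_nonsing_inv _ hdet, Matrix.map_one c (map_zero c) (map_one c), Matrix.transpose_one]
  have hTinv : (Matrix.diagonal t)⁻¹ = Matrix.diagonal (fun i => (t i)⁻¹) := by
    refine Matrix.inv_eq_left_inv ?_
    rw [Matrix.diagonal_mul_diagonal, ← Matrix.diagonal_one]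
    congr 1
    funext i
    exact inv_mul_cancel₀ (ht i)
  rw [← Matrix.mulVec_mulVec, ← Matrix.mulVec_mulVec, hu, Matrix.mulVec_smul, ← conjTranspose_updateRow_one_mulVec_single c k w, Matrix.mulVec_mulVec, hinv,
    Matrix.one_mulVec, Matrix.mulVec_smul, hTinv, Matrix.diagonal_mulVec_single, mul_one]
  ext i
  by_cases hi : i = k
  · subst hi; simp
  · simp [hi]

/-- **THE CONJUGATED INDEX OF A RANK-ONE SKEW INDEX IS CORNER-SUPPORTED**: for `S = u ⊗ w` `T`-skew (`T = diag(t)` invertible), `w_k ≠ 0`,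
`A₀ = 1.updateRow k w` and `D₀ = T⁻¹ (A₀⁻¹)^* T`: `D₀ S A₀⁻¹ = E_k (D₀ S A₀⁻¹) E_k` for the singleton pattern `χ_k`. [cite: KudlaRallis1994, §2]
[cite: Shimura1997, §18.3] -/
theorem conj_index_eq_corner (c : K →+* K) {t : ι → K} (ht : ∀ i, t i ≠ 0) {S : Matrix ι ι K} {u w : ι → K} (hS1 : S = Matrix.vecMulVec u w)
    (hS : Matrix.diagonal t * S + (S.map c)ᵀ * Matrix.diagonal t = 0) {k : ι} (hk : w k ≠ 0) :
    (Matrix.diagonal t)⁻¹ * ((((1 : Matrix ι ι K).updateRow k w)⁻¹).map c)ᵀ * Matrix.diagonal t * S * ((1 : Matrix ι ι K).updateRow k w)⁻¹ =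
      Matrix.diagonal (fun i => if i = k then (1 : K) else 0) *
        ((Matrix.diagonal t)⁻¹ * ((((1 : Matrix ι ι K).updateRow k w)⁻¹).map c)ᵀ * Matrix.diagonal t * S * ((1 : Matrix ι ι K).updateRow k w)⁻¹) *
        Matrix.diagonal (fun i => if i = k then (1 : K) else 0) := by
  have hu := mulVec_eq_smul_of_skew c hS1 hS hk
  have hD := leviD_mulVec_eq_smul_single c ht hk hu
  have hshape : (Matrix.diagonal t)⁻¹ * ((((1 : Matrix ι ι K).updateRow k w)⁻¹).map c)ᵀ * Matrix.diagonal t * S * ((1 : Matrix ι ι K).updateRow k w)⁻¹ =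
      Matrix.vecMulVec (((-(((fun i => c (u i)) ᵥ* Matrix.diagonal t) k / w k)) * (t k)⁻¹) • Pi.single k (1 : K)) (Pi.single k (1 : K)) := by
    rw [hS1, Matrix.mul_vecMulVec, Matrix.vecMulVec_mul, vecMul_updateRow_one_inv hk]
    congr 1
  rw [hshape, Matrix.mul_vecMulVec, Matrix.vecMulVec_mul]
  congr 1
  · ext i
    rw [Matrix.mulVec_diagonal]
    by_cases hi : i = k
    · subst hi; simp
    · simp [hi]
  · ext j
    rw [Matrix.vecMul_diagonal]
    by_cases hj : j = k
    · subst hj; simp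
    · simp [hj]

end LinearAlgebra

/-! ## §2 The rational Levi element of `A₀` and the corner-supported conjugated index in `H(𝔸)` -/

section Doubled

variable (L : Type) [Field L] [NumberField L] [IsCMField L]
variable {N M n : ℕ} (e : Fin N × Fin M ≃ Fin n)
  (dV : Fin N → L) (hdV : ∀ i, IsCMField.complexConj L (dV i) = dV i)
  (dW : Fin M → L) (hdW : ∀ i, IsCMField.complexConj L (dW i) = dW i)

/-- **Φ7-1 (i): A RANK-ONE `T_L`-SKEW INDEX HAS A CORNER-SUPPORTED CONJUGATE.**  For `S = u ⊗ w` `T_L`-skew with `w_k ≠ 0` there is a rational Siegel element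
`p' ∈ P_Δ(L⁺)` (the Levi element of `A₀ = 1.updateRow k w`) whose conjugated index `S^{p'}_𝔸 = frame₂₂ p' · S_𝔸 · (deltaBlock p')⁻¹` is supported on the
corner of the singleton pattern `χ_k` — the currency of ★ `K2LiuSiegelEisensteinCoeffOrbitCriterion` (its sharp criterion then says the orbit of
`[w_{χ_k} p']` has no killing datum). [cite: KudlaRallis1994, §2] [cite: Shimura1997, §18.3] [cite: MoeglinWaldspurger1995, II.1.7] -/
theorem exists_corner_supported_levi (hdV0 : ∀ i, dV i ≠ 0) (hdW0 : ∀ i, dW i ≠ 0) {S : Matrix (Fin n) (Fin n) L}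
    (hS : S ∈ skewMatrices ((IsCMField.complexConj L : L ≃ₐ[Fp L] L) : L →+* L) ((gramR L e dV hdV dW hdW).map (algebraMap (Fp L) L)))
    {u w : Fin n → L} (hS1 : S = Matrix.vecMulVec u w) {k : Fin n} (hk : w k ≠ 0) :
    ∃ p' : HA L e dV hdV dW hdW, p' ∈ ratH L e dV hdV dW hdW ∧ IsSiegelDelta L e dV hdV dW hdW p' ∧
      deltaBlock L e dV hdV dW hdW p' = ((1 : Matrix (Fin n) (Fin n) L).updateRow k w).map (algebraMap L (AdeleRing (𝓞 L) L)) ∧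
      (Matrix.fromBlocks (1 : Matrix (Fin n) (Fin n) (AdeleRing (𝓞 L) L)) 0 (-1) 1 * blk L e dV hdV dW hdW p' * Matrix.fromBlocks 1 0 1 1).toBlocks₂₂ *
          S.map (algebraMap L (AdeleRing (𝓞 L) L)) * (deltaBlock L e dV hdV dW hdW p')⁻¹ =
        Matrix.diagonal (fun i => algebraMap L (AdeleRing (𝓞 L) L) (if i = k then (1 : L) else 0)) *
          ((Matrix.fromBlocks (1 : Matrix (Fin n) (Fin n) (AdeleRing (𝓞 L) L)) 0 (-1) 1 * blk L e dV hdV dW hdW p' * Matrix.fromBlocks 1 0 1 1).toBlocks₂₂ *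
            S.map (algebraMap L (AdeleRing (𝓞 L) L)) * (deltaBlock L e dV hdV dW hdW p')⁻¹) *
          Matrix.diagonal (fun i => algebraMap L (AdeleRing (𝓞 L) L) (if i = k then (1 : L) else 0)) := by
  obtain ⟨hT, hTσ, hTt, -⟩ := gramRL_facts L e dV hdV dW hdW hdV0 hdW0
  -- the Levi matrix and its rational Levi element
  have hA₀ : IsUnit ((1 : Matrix (Fin n) (Fin n) L).updateRow k w).det := by rw [det_updateRow_one]; exact isUnit_iff_ne_zero.2 hk
  have hA₀u : IsUnit ((1 : Matrix (Fin n) (Fin n) L).updateRow k w) := (Matrix.isUnit_iff_isUnit_det _).2 hA₀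
  obtain ⟨p', hp'r, hp'P, b, d, hframe⟩ := exists_rat_siegel_frame₁₁ L e dV hdV dW hdW hdV0 hdW0 hA₀u.unit
  rw [hA₀u.unit_spec] at hframe
  have hdelta : deltaBlock L e dV hdV dW hdW p' = ((1 : Matrix (Fin n) (Fin n) L).updateRow k w).map (algebraMap L (AdeleRing (𝓞 L) L)) := by
    rw [deltaBlock_eq_conj, hframe, Matrix.toBlocks_fromBlocks₁₁]
  -- the rational blocks of `p'`: `A₀' = A₀`, `D₀' = T⁻¹ (A₀⁻¹)^* T`
  obtain ⟨A₀', D₀', hA₀', ha', hd', hrel⟩ := exists_rat_levi_blocks L e dV hdV dW hdW hdV0 hdW0 hp'P hp'r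
  have hinj : Function.Injective (fun A : Matrix (Fin n) (Fin n) L => A.map (algebraMap L (AdeleRing (𝓞 L) L))) :=
    fun A B h => Matrix.ext fun i j => AdeleRing.algebraMap_injective (𝓞 L) L (congrFun (congrFun h i) j)
  have hAA : A₀' = (1 : Matrix (Fin n) (Fin n) L).updateRow k w := hinj (ha'.symm.trans hdelta)
  subst hAA
  have hDD : D₀' = ((gramR L e dV hdV dW hdW).map (algebraMap (Fp L) L))⁻¹ *
      ((((1 : Matrix (Fin n) (Fin n) L).updateRow k w)⁻¹).map ((IsCMField.complexConj L : L ≃ₐ[Fp L] L) : L →+* L))ᵀ *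
      (gramR L e dV hdV dW hdW).map (algebraMap (Fp L) L) := by
    -- from `A₀^* T D₀' = T`: `D₀' = (A₀^* T)⁻¹ T = T⁻¹ (A₀^*)⁻¹ T`, and `(A₀^*)⁻¹ = (A₀⁻¹)^*`
    have hcs : IsUnit ((((1 : Matrix (Fin n) (Fin n) L).updateRow k w).map ((IsCMField.complexConj L : L ≃ₐ[Fp L] L) : L →+* L))ᵀ).det := by
      rw [Matrix.det_transpose, ← RingHom.mapMatrix_apply, ← RingHom.map_det]; exact hA₀.map _
    have hinvcs : ((((1 : Matrix (Fin n) (Fin n) L).updateRow k w)⁻¹).map ((IsCMField.complexConj L : L ≃ₐ[Fp L] L) : L →+* L))ᵀ =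
        (((((1 : Matrix (Fin n) (Fin n) L).updateRow k w)).map ((IsCMField.complexConj L : L ≃ₐ[Fp L] L) : L →+* L))ᵀ)⁻¹ := by
      refine Matrix.inv_eq_left_inv ?_ |>.symm
      rw [← Matrix.transpose_mul, ← Matrix.map_mul, Matrix.mul_nonsing_inv _ hA₀, Matrix.map_one _ (map_zero _) (map_one _), Matrix.transpose_one]
    have h1 : D₀' = ((((1 : Matrix (Fin n) (Fin n) L).updateRow k w).map ((IsCMField.complexConj L : L ≃ₐ[Fp L] L) : L →+* L))ᵀ *
        (gramR L e dV hdV dW hdW).map (algebraMap (Fp L) L))⁻¹ * (gramR L e dV hdV dW hdW).map (algebraMap (Fp L) L) := by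
      have hu : IsUnit ((((1 : Matrix (Fin n) (Fin n) L).updateRow k w).map ((IsCMField.complexConj L : L ≃ₐ[Fp L] L) : L →+* L))ᵀ *
          (gramR L e dV hdV dW hdW).map (algebraMap (Fp L) L)).det := by rw [Matrix.det_mul]; exact hcs.mul hT
      rw [← Matrix.nonsing_inv_mul_cancel_left _ D₀' hu, hrel]
    rw [h1, Matrix.mul_inv_rev, hinvcs]
  -- corner support over `L`, then transport along `L → 𝔸_L`
  obtain ⟨t₀, ht₀⟩ : ∃ t : Fin n → L, (gramR L e dV hdV dW hdW).map (algebraMap (Fp L) L) = Matrix.diagonal t := by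
    have hex : ∃ t : Fin n → Fp L, gramR L e dV hdV dW hdW = Matrix.diagonal t := by
      refine ⟨(fun mn : Fin N × Fin M => (⟨dV mn.1, (IsCMField.complexConj_eq_self_iff (K := L) (dV mn.1)).1 (hdV mn.1)⟩ : Fp L) *
        (⟨dW mn.2, (IsCMField.complexConj_eq_self_iff (K := L) (dW mn.2)).1 (hdW mn.2)⟩ : Fp L)) ∘ e.symm, ?_⟩
      unfold gramR gram realDiagonal
      rw [Matrix.diagonal_kronecker_diagonal, Matrix.reindex_apply, Matrix.submatrix_diagonal_equiv]
    obtain ⟨t, ht⟩ := hex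
    exact ⟨fun i => algebraMap (Fp L) L (t i), by rw [ht, Matrix.diagonal_map (map_zero _)]⟩
  have ht0 : ∀ i, t₀ i ≠ 0 := by
    intro i hi
    have hdet := hT
    rw [ht₀, Matrix.det_diagonal] at hdet
    exact (Finset.prod_ne_zero_iff.1 (hdet.ne_zero)) i (Finset.mem_univ i) hi
  have hcornerL := conj_index_eq_corner ((IsCMField.complexConj L : L ≃ₐ[Fp L] L) : L →+* L) ht0 hS1 (by rw [← ht₀]; exact hS) hk
  rw [← ht₀] at hcornerL
  refine ⟨p', hp'r, hp'P, hdelta, ?_⟩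
  rw [hd', hdelta, ← map_nonsing_inv_of_isUnit _ hA₀, ← Matrix.map_mul, ← Matrix.map_mul, hDD]
  conv_lhs => rw [hcornerL]
  rw [Matrix.map_mul, Matrix.map_mul, Matrix.diagonal_map (map_zero _)]

end Doubled

end Summit.HodgeConjecture.HodgeConjecture.Cruxes.HLiu418.K2LiuSiegelEisensteinCoeffRankOneCorner

end
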